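/-
Copyright: literature formalisation for the harness. Statements follow the cited text.
-/
import Literature.AlgebraicGeometry.CossartPiltant200819.PGroupClimb2008
import Literature.AlgebraicGeometry.Resolution.KrullRamificationGroups
import HarnessLib

/-!
# Cossart–Piltant I (2008), Thm 7.2 — the Galois segment `K₀ → K₀ⁱ → K₀ʳ → K ʳ → K`

Sequel to `PGroupClimb2008`. The Galois part of the tower in the proof of Thm 7.2 (HAL
pp. 20–21): for `L/K` finite Galois with valuation ring `W` of `L`, `V = W ∩ K`, inertia group
`G_i` and ramification group `G_r` of `W/V` with fixed fields `Kⁱ ⊆ Kʳ`, and ANY intermediate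
field `M` (in HAL: `M = K₁`, the separable closure of `K₀` in the function field),

  `(K, V) → (Kⁱ, W ∩ Kⁱ)` by Cor 6.3 (`inertiaUp`),
  `(Kⁱ, ·) → (Kʳ, ·)` along the abelian prime-to-`p` tower `Kʳ/Kⁱ` (HAL (8); `primeUp` steps),
  `(Kʳ, ·) → (Mʳ, ·)` with `Mʳ := L^{G_r ∩ Gal(L/M)}` the ramification field of `W` over `W ∩ M`
    (Lemma 6.1: `G_r(W/W∩M) = G_r(W/V) ∩ Gal(L/M)`), a tower of Galois steps of degree `p` inside
    the `p`-group `G_r` (`PGroupClimb2008`),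
  `(Mʳ, ·) → (M, W ∩ M)` by Prop 9.5 (`ramificationDown`).

PROVED here (kernel-checked, no `sorry`):

* `inertiaGroup W`, `ramificationGroup W : Subgroup (L ≃ₐ[K] L)` — the groups of
  `LocalModels2008.InInertiaGroup` / `InRamificationGroup` as subgroups (`mem_…_iff`), the latter
  transported from `Resolution.ramificationGroupIn` (Zariski–Samuel VI §12) with `Ω := L`;
* `isPGroup_ramificationGroup` — **`G_r` is a `p`-group** (ZS VI §12 Thm 24, imported from
  `Resolution.isPGroup_ramificationGroupIn` through the transport `autTopHom`);
* `smul_eq_of_mem_ramificationGroup` — `G_r` fixes `W`;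
* `CReach3.galoisSegment` — the displayed chain: GIVEN the tame climb `(Kⁱ, ·) → (Kʳ, ·)` as a
  hypothesis, `(K, W ∩ K)` reaches `(M, W ∩ M)` for every intermediate field `M`;
* the named residual fact `TameSegmentClimb2008 k` (the climb of `Kʳ/Kⁱ`, HAL (8): "`K₀ʳ/K₀ⁱ` is
  an Abelian extension of order prime to `p`, whence a tower of Abelian extensions of prime
  degrees `lᵢ ≠ p`", each totally ramified) and `CReach3.galoisSegment_of_tame`.

So the Galois side of the tower is reduced to the single valuation-theoretic input
`TameSegmentClimb2008` (Krull/ZS VI §12 Thm 25: `Kʳ/Kⁱ` is defectless and totally ramified);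
with `InseparableClimb2008` the residual of `CoarseTowerExists2008` is that input plus the
set-up bookkeeping (Galois closure of `K₁/K₀`, Chevalley extension of `V ∩ K₁`, finiteness of
`K/k(x)`). [cite: CossartPiltant2008, Thm 7.2 proof (HAL pp. 20–21)]
-/

namespace Literature.AlgebraicGeometry.CossartPiltant200819.CP2008

open Literature.AlgebraicGeometry.Resolution IsLocalRing IntermediateField
open scoped Pointwise IntermediateField

universe u

section Groups

variable {K L : Type u} [Field K] [Field L] [Algebra K L]

/-- The base field as a subfield of the top field. [folklore] -/
abbrev baseSubfield (K L : Type u) [Field K] [Field L] [Algebra K L] : Subfield L :=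
  (algebraMap K L).fieldRange

/-- A `K`-automorphism of `L` as an automorphism of `⊤ : IntermediateField (K-range) L` (the
shape on which `Resolution.KrullRamificationGroups` is stated, with `Ω := L`). [folklore] -/
def autTop (σ : L ≃ₐ[K] L) :
    (⊤ : IntermediateField (baseSubfield K L) L) ≃ₐ[baseSubfield K L]
      (⊤ : IntermediateField (baseSubfield K L) L) where
  toFun x := ⟨σ (x : L), IntermediateField.mem_top⟩
  invFun x := ⟨σ.symm (x : L), IntermediateField.mem_top⟩
  left_inv x := Subtype.ext (σ.symm_apply_apply (x : L))
  right_inv x := Subtype.ext (σ.apply_symm_apply (x : L))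
  map_mul' x y := Subtype.ext (map_mul σ (x : L) (y : L))
  map_add' x y := Subtype.ext (map_add σ (x : L) (y : L))
  commutes' c := Subtype.ext (by
    obtain ⟨a, ha⟩ := RingHom.mem_fieldRange.mp c.2
    change σ (c : L) = (c : L)
    rw [← ha, AlgEquiv.commutes])

/-- `autTop σ` acts as `σ` on the underlying elements. [folklore] -/
@[simp] theorem coe_autTop_apply (σ : L ≃ₐ[K] L) (x : (⊤ : IntermediateField (baseSubfield K L) L)) :
    ((autTop σ x : (⊤ : IntermediateField (baseSubfield K L) L)) : L) = σ (x : L) := rfl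

/-- `autTop` as a group homomorphism. [folklore] -/
def autTopHom : (L ≃ₐ[K] L) →*
    ((⊤ : IntermediateField (baseSubfield K L) L) ≃ₐ[baseSubfield K L]
      (⊤ : IntermediateField (baseSubfield K L) L)) where
  toFun := autTop
  map_one' := by ext x; rfl
  map_mul' σ τ := by ext x; rfl

/-- `autTopHom` is injective. [folklore] -/
theorem autTopHom_injective : Function.Injective (autTopHom (K := K) (L := L)) := fun σ τ h => by
  ext x
  exact congrArg (fun φ => ((φ ⟨x, IntermediateField.mem_top⟩ :
    (⊤ : IntermediateField (baseSubfield K L) L)) : L)) h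

/-- **The inertia group `G_i(W/V) ≤ Gal(L/K)`** (HAL p. 5, (3)) as a subgroup: Mathlib's
inertia subgroup of the decomposition subgroup, pushed into `Gal(L/K)`.
[cite: CossartPiltant2008, Section 3 (HAL p. 5, (2)–(3))] -/
noncomputable def inertiaGroup (W : ValuationSubring L) : Subgroup (L ≃ₐ[K] L) :=
  (W.inertiaSubgroup K).map (W.decompositionSubgroup K).subtype

/-- Membership in `inertiaGroup` is `InInertiaGroup`. [folklore] -/
theorem mem_inertiaGroup_iff (W : ValuationSubring L) (σ : L ≃ₐ[K] L) :
    σ ∈ inertiaGroup W ↔ InInertiaGroup K W σ := by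
  constructor
  · rintro ⟨τ, hτ, rfl⟩
    exact ⟨τ.2, hτ⟩
  · rintro ⟨h, hmem⟩
    exact ⟨⟨σ, h⟩, hmem, rfl⟩

/-- **The ramification group `G_r(W/V) ≤ Gal(L/K)`** (HAL p. 6) as a subgroup, transported
from `Resolution.ramificationGroupIn` (Zariski–Samuel VI §12 (17)) with `Ω := L`.
[cite: CossartPiltant2008, Section 3 (HAL p. 6, definition of `G_r`)] -/
def ramificationGroup (W : ValuationSubring L) : Subgroup (L ≃ₐ[K] L) :=
  (ramificationGroupIn W (⊤ : IntermediateField (baseSubfield K L) L)).comap autTopHom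

/-- Membership in `ramificationGroup`: `v(σ x − x) > v(x)` for all `x ≠ 0`. [folklore] -/
theorem mem_ramificationGroup_iff (W : ValuationSubring L) (σ : L ≃ₐ[K] L) :
    σ ∈ ramificationGroup W ↔ ∀ x : L, x ≠ 0 → W.valuation (σ x - x) < W.valuation x := by
  rw [ramificationGroup, Subgroup.mem_comap, mem_ramificationGroupIn_iff]
  constructor
  · intro h x hx
    exact h ⟨x, IntermediateField.mem_top⟩ fun h0 => hx (congrArg Subtype.val h0)
  · intro h x hx
    exact h x fun h0 => hx (Subtype.ext h0)

/-- An element of `InRamificationGroup` lies in `ramificationGroup`. [folklore] -/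
theorem mem_ramificationGroup_of_inRamificationGroup (W : ValuationSubring L) {σ : L ≃ₐ[K] L}
    (h : InRamificationGroup K W σ) : σ ∈ ramificationGroup W :=
  (mem_ramificationGroup_iff W σ).mpr h.2

/-- **`G_r` fixes `W`** (`G_r ⊆ G_s`). [folklore] -/
theorem smul_eq_of_mem_ramificationGroup (W : ValuationSubring L) {σ : L ≃ₐ[K] L}
    (hσ : σ ∈ ramificationGroup W) : σ • W = W := by
  rw [mem_ramificationGroup_iff] at hσ
  have hv : ∀ x : L, W.valuation (σ x) = W.valuation x := fun x => by
    by_cases hx : x = 0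
    · rw [hx, map_zero]
    · exact Valuation.map_eq_of_sub_lt _ (hσ x hx)
  ext x
  rw [ValuationSubring.mem_pointwise_smul_iff_inv_smul_mem, ← W.valuation_le_one_iff,
    ← W.valuation_le_one_iff x, AlgEquiv.smul_def, ← hv (σ⁻¹ x),
    show σ (σ⁻¹ x) = x from AlgEquiv.apply_symm_apply σ x]

/-- The residue field of a valuation ring containing a field of characteristic `p` has
characteristic `p`. [folklore] -/
theorem charP_residueField {k : Type u} [Field k] [Algebra k L] (p : ℕ) [CharP k p]
    (W : ValuationSubring L) (hkW : ∀ c : k, algebraMap k L c ∈ W) :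
    CharP (ResidueField W) p :=
  charP_of_injective_ringHom
    ((IsLocalRing.residue W).comp ((algebraMap k L).codRestrict W hkW)).injective p

/-- **The ramification group is a `p`-group**, `p` the residue characteristic (Zariski–Samuel
VI §12 Thm 24, `Resolution.isPGroup_ramificationGroupIn`, transported).
[cite: ZariskiSamuel1960, Ch. VI §12, Thm. 24, p. 77] -/
theorem isPGroup_ramificationGroup {p : ℕ} [Fact p.Prime] [FiniteDimensional K L]
    (W : ValuationSubring L) [CharP (ResidueField W) p] :
    IsPGroup p (ramificationGroup (K := K) W) := by
  letI : Algebra K (baseSubfield K L) := (algebraMap K L).rangeRestrictField.toAlgebra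
  haveI : IsScalarTower K (baseSubfield K L) L := IsScalarTower.of_algebraMap_eq fun x => rfl
  haveI : FiniteDimensional (baseSubfield K L) L :=
    Module.Finite.of_restrictScalars_finite K (baseSubfield K L) L
  haveI : FiniteDimensional (baseSubfield K L) (⊤ : IntermediateField (baseSubfield K L) L) :=
    LinearEquiv.finiteDimensional
      (IntermediateField.topEquiv (F := baseSubfield K L) (E := L)).symm.toLinearEquiv
  have hP := isPGroup_ramificationGroupIn W (⊤ : IntermediateField (baseSubfield K L) L) (p := p)
  let φ : ramificationGroup (K := K) W →*
      ramificationGroupIn W (⊤ : IntermediateField (baseSubfield K L) L) :=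
    (autTopHom.comp (ramificationGroup W).subtype).codRestrict _ fun g => g.2
  exact hP.of_injective φ fun a b h =>
    Subtype.ext (autTopHom_injective (congrArg Subtype.val h))

/-- If `σ.restrictScalars K` fixes `W` then so does `σ`. [folklore] -/
theorem smul_eq_of_restrictScalars_smul_eq (M : IntermediateField K L) (W : ValuationSubring L)
    (σ : L ≃ₐ[M] L) (h : (σ.restrictScalars K) • W = W) : σ • W = W := by
  ext x
  conv_rhs => rw [← h]
  rw [ValuationSubring.mem_smul_pointwise_iff_exists,
    ValuationSubring.mem_smul_pointwise_iff_exists]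
  exact Iff.rfl

end Groups

section Segment

variable {k : Type u} [Field k]

/-- **The Galois segment of the tower of Thm 7.2** (PROVED modulo the tame climb): `L/K`
finite Galois, `W` a valuation ring of `L` containing `k` (`char k = p`), `Kⁱ ⊆ Kʳ` the inertia
and ramification fields of `W` over `W ∩ K`. IF `(Kⁱ, W ∩ Kⁱ)` reaches `(Kʳ, W ∩ Kʳ)` (the tame
climb, HAL (8)), THEN `(K, W ∩ K)` reaches `(M, W ∩ M)` for every intermediate field `M`:
`inertiaUp` (Cor 6.3) · tame · the `p`-group climb inside `G_r` up to the ramification field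
`Mʳ = L^{G_r ∩ Gal(L/M)}` of `W` over `W ∩ M` (Lemma 6.1) · `ramificationDown` (Prop 9.5).
[cite: CossartPiltant2008, Thm 7.2 proof (HAL pp. 20–21)] -/
theorem CReach3.galoisSegment (p : ℕ) (hp : p.Prime) (hchar : CharP k p) {K L : Type u}
    [Field K] [Algebra k K] [Field L] [Algebra K L] [Algebra k L] [IsScalarTower k K L]
    [FiniteDimensional K L] [IsGalois K L] (W : ValuationSubring L)
    (hkW : ∀ c : k, algebraMap k L c ∈ W)
    (htame : CReach3 k
      ⟨fixedField (inertiaGroup (K := K) W),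
        W.comap (algebraMap (fixedField (inertiaGroup (K := K) W)) L),
        forall_algebraMap_mem_comap_intermediateField hkW _⟩
      ⟨fixedField (ramificationGroup (K := K) W),
        W.comap (algebraMap (fixedField (ramificationGroup (K := K) W)) L),
        forall_algebraMap_mem_comap_intermediateField hkW _⟩)
    (M : IntermediateField K L) :
    CReach3 k ⟨K, W.comap (algebraMap K L), forall_algebraMap_mem_comap hkW⟩
      ⟨M, W.comap (algebraMap M L), forall_algebraMap_mem_comap_intermediateField hkW M⟩ := by
  haveI : Fact p.Prime := ⟨hp⟩
  haveI := hchar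
  haveI : CharP (ResidueField W) p := charP_residueField p W hkW
  -- (1) `K → Kⁱ` : Cor 6.3
  have h1 : CMove3 k ⟨K, W.comap (algebraMap K L), forall_algebraMap_mem_comap hkW⟩
      ⟨fixedField (inertiaGroup (K := K) W),
        W.comap (algebraMap (fixedField (inertiaGroup (K := K) W)) L),
        forall_algebraMap_mem_comap_intermediateField hkW _⟩ :=
    CMove3.inertiaUp inferInstance inferInstance W hkW (fixedField (inertiaGroup W))
      fun σ hσ x hx => (mem_fixedField_iff _ x).mp hx σ ((mem_inertiaGroup_iff W σ).mpr hσ)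
  -- (3) `Kʳ → Mʳ` : the `p`-group climb inside `G_r`
  set GV : Subgroup (L ≃ₐ[K] L) := ramificationGroup W with hGV
  set Kr : IntermediateField K L := fixedField GV with hKr
  set Mr : IntermediateField K L := fixedField (GV ⊓ M.fixingSubgroup) with hMr
  have hKrMr : Kr ≤ Mr := fun x hx =>
    (mem_fixedField_iff _ x).mpr fun σ hσ => (mem_fixedField_iff _ x).mp hx σ hσ.1
  have hfix : Kr.fixingSubgroup = GV := fixingSubgroup_fixedField GV
  haveI : IsScalarTower k Kr L := isScalarTower_intermediateField' (k := k) Kr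
  have hPKr : IsPGroup p (L ≃ₐ[Kr] L) := by
    have hP' : IsPGroup p Kr.fixingSubgroup := by
      rw [hfix]
      exact isPGroup_ramificationGroup W
    exact hP'.of_equiv (IntermediateField.fixingSubgroupEquiv Kr)
  have hWKr : ∀ σ : L ≃ₐ[Kr] L, σ • W = W := fun σ => by
    have hmem : σ.restrictScalars K ∈ GV := by
      rw [← hfix, IntermediateField.mem_fixingSubgroup_iff]
      intro x hx
      exact σ.commutes ⟨x, hx⟩
    exact smul_eq_of_restrictScalars_smul_eq Kr W σ (smul_eq_of_mem_ramificationGroup W hmem)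
  have h3 := CReach3.of_isPGroup p hp hchar (F := Kr) (L := L) hPKr W hkW hWKr
    (extendScalars hKrMr)
  -- (4) `Mʳ → M` : Prop 9.5 (Lemma 6.1: `G_r(W/W∩M) = G_r ∩ Gal(L/M)`)
  have hMMr : M ≤ Mr := fun x hx =>
    (mem_fixedField_iff _ x).mpr fun σ hσ => by
      have h2 := (Subgroup.mem_inf.mp hσ).2
      rw [IntermediateField.mem_fixingSubgroup_iff] at h2
      exact h2 x hx
  haveI : IsScalarTower k M L := isScalarTower_intermediateField' (k := k) M
  have h4 : CMove3 k
      ⟨extendScalars hMMr, W.comap (algebraMap (extendScalars hMMr) L),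
        forall_algebraMap_mem_comap_intermediateField hkW _⟩
      ⟨M, W.comap (algebraMap M L), forall_algebraMap_mem_comap_intermediateField hkW M⟩ := by
    refine CMove3.ramificationDown inferInstance inferInstance W hkW (extendScalars hMMr)
      fun σ hσ x hx => ?_
    have hv : σ.restrictScalars K ∈ GV :=
      (mem_ramificationGroup_iff W _).mpr hσ.2
    have hfixM : σ.restrictScalars K ∈ M.fixingSubgroup := by
      rw [IntermediateField.mem_fixingSubgroup_iff]
      intro y hy
      exact σ.commutes ⟨y, hy⟩
    exact (mem_fixedField_iff _ x).mp hx (σ.restrictScalars K) ⟨hv, hfixM⟩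
  exact ((Relation.ReflTransGen.head h1 htame).trans h3).tail h4

/-- **The tame climb `(Kⁱ, W ∩ Kⁱ) → (Kʳ, W ∩ Kʳ)`** — named residual fact (HAL (8), proof of
Thm 7.2 p. 20: "`K₀ʳ/K₀ⁱ` is an Abelian extension of order prime to `p`, whence a tower of Abelian
extensions of prime degrees `lᵢ ≠ p`. Therefore, using induction on `[K₀ʳ : K₀ⁱ]`, `W ∩ K₀ʳ/k` has
a local uniformization by proposition 8.3 (2)"): for `L/K` finite Galois and `W` a valuation
ring of `L` containing `k`, the stage `(Kⁱ, W ∩ Kⁱ)` reaches `(Kʳ, W ∩ Kʳ)` by coarse moves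
(intended: `primeUp` steps of prime degree `ℓ ≠ p` with `e = ℓ`, `Kʳ/Kⁱ` being defectless and
totally ramified with group `G_i/G_r ↪ Hom(Γ_W/Γ_V, κ(W)ˣ)`, Zariski–Samuel VI §12 Thm 25).
[cite: CossartPiltant2008, Thm 7.2 proof (HAL p. 20, (8))] -/
def TameSegmentClimb2008 (k : Type u) [Field k] : Prop :=
  ∀ (p : ℕ), p.Prime → CharP k p → ∀ (K : Type u) [Field K] [Algebra k K] (L : Type u)
    [Field L] [Algebra K L] [Algebra k L] [IsScalarTower k K L] [FiniteDimensional K L]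
    [IsGalois K L] (W : ValuationSubring L) (hkW : ∀ c : k, algebraMap k L c ∈ W),
    CReach3 k
      ⟨fixedField (inertiaGroup (K := K) W),
        W.comap (algebraMap (fixedField (inertiaGroup (K := K) W)) L),
        forall_algebraMap_mem_comap_intermediateField hkW _⟩
      ⟨fixedField (ramificationGroup (K := K) W),
        W.comap (algebraMap (fixedField (ramificationGroup (K := K) W)) L),
        forall_algebraMap_mem_comap_intermediateField hkW _⟩

/-- **The Galois segment, from the tame climb**: under `TameSegmentClimb2008 k`, for `L/K`
finite Galois and any valuation ring `W ⊇ k` of `L`, `(K, W ∩ K)` reaches `(M, W ∩ M)` for every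
intermediate field `M`. [cite: CossartPiltant2008, Thm 7.2 proof (HAL pp. 20–21)] -/
theorem CReach3.galoisSegment_of_tame (htame : TameSegmentClimb2008 k) (p : ℕ) (hp : p.Prime)
    (hchar : CharP k p) {K L : Type u} [Field K] [Algebra k K] [Field L] [Algebra K L]
    [Algebra k L] [IsScalarTower k K L] [FiniteDimensional K L] [IsGalois K L]
    (W : ValuationSubring L) (hkW : ∀ c : k, algebraMap k L c ∈ W) (M : IntermediateField K L) :
    CReach3 k ⟨K, W.comap (algebraMap K L), forall_algebraMap_mem_comap hkW⟩
      ⟨M, W.comap (algebraMap M L), forall_algebraMap_mem_comap_intermediateField hkW M⟩ :=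
  CReach3.galoisSegment p hp hchar W hkW (htame p hp hchar K L W hkW) M

end Segment

end Literature.AlgebraicGeometry.CossartPiltant200819.CP2008
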